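import Literature.AnabelianGeometry.SemiGraphs.ArithThm54DesignInputsLoopWitness
import Literature.AnabelianGeometry.SemiGraphs.TemperedGroups
import HarnessLib

/-!
# [SemiAnbd] Thm 5.4 capstones — the FRAME instances (profinite `Π_A`, finite semi-graph) and the discharged
# binder `hA : IsTempered Π_A` are jointly inhabited at the estranged-loop witness `𝒢₁` with `Π_A := Aff(ℤ_p)` (NV)

Mochizuki, *Semi-graphs of anabelioids*, Publ. RIMS **42** (2006), §5 Def 5.1 (i) p. 62 ("Let `A` be a slim connected
anabelioid … so we may speak of `π̂₁(A)`"), Thm 5.4 p. 66; §3 Rmk 3.1.1 p. 33 ("every profinite group is tempered")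
[cite: MochizukiSemiAnbd2006, Thm 5.4 (i) p.66].

PROOF-ONLY non-vacuity file (cell abc-iut, layer L3, T54-B binder board, NV column, row «frame-instance NV at the loop
witness», seat abc-iut-w6-d085, L3-lead α83; no definition, no instance, no new named fact).  The T54-B capstones of
record (`ArithThm54CapstonesChartOfProducers.lean` p436631, `ArithThm54CapstoneCorollaryTopology.lean` p435643 and the
`…Profinite` sequel of this seat) carry, besides the Prop-valued residual binders, the FRAME: `Π_A` a compact (and,
for the Rmk 3.1.1 discharge of `hA : IsTempered Π_A`, totally disconnected — i.e. profinite, Def 5.1 (i)) topological group,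
`E := π₁^temp(𝒢) ⋊^out Π_A` Hausdorff, the semi-graph finite (`[Finite Vertex] [Finite Branch] [Finite Edge]`).
abc-iut-w6-d099's `capstoneDesignInputs_loopGraph_padicAffine` (ArithThm54DesignInputsLoopWitness.lean, p435012) inhabits
the DESIGN inputs at abc-iut-L3-t8's estranged loop `𝒢₁ = IwahoriWitness.loopGraph p` with `Π_A := Aff(ℤ_p)`
(`PadicAffine p`, abc-iut cell `Literature.GroupTheory.SpecificGroups`).  Here the FRAME column is certified at the same
datum, so that the two certificates together show the capstone's non-topological hypothesis frame is consistent at a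
genuinely profinite, NON-discrete arithmetic group:

* `capstoneFrameInstances_loopGraph_padicAffine` — `𝒢₁` has finite vertex/branch/edge types (one vertex, one loop),
  `Aff(ℤ_p)` is a compact, Hausdorff, totally disconnected topological group (tree instances of
  `PadicAffineGroup.lean`), hence TEMPERED (the tree's `isTempered_padicAffine` = `IsTempered.of_profinite`, the T54·hA discharge term, Prop36HypothesesWitness.lean), and its `{1}` is not
  open (abc-iut-w6-d099's `not_isOpen_singleton_one_padicAffine`, so the `hbot`-side of the design column is the
  non-degenerate one).

Honest framing: a witness certifies consistency of the binder FRAME only (the LEVEL-B topology on `E` and the producer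
binders are certified elsewhere / remain on the board); nothing of [SemiAnbd] is asserted beyond Rmk 3.1.1's tree
theorem; nothing here bears on [IUTchIII] Cor. 3.12; typed ≠ proved.
-/

noncomputable section

namespace Literature.AnabelianGeometry.SemiGraphs

namespace ProfiniteSemiGraph

open Literature.AnabelianGeometry.EtaleTheta CategoryTheory Topology
open Literature.GroupTheory.SpecificGroups

variable (p : ℕ) [Fact p.Prime]

/-- **FRAME-INSTANCE NV at the loop witness**: at `𝒢₁ = IwahoriWitness.loopGraph p` and `Π_A := Aff(ℤ_p)` the frame of
the T54-B capstones is inhabited — finite vertex, branch AND edge types; `Π_A` compact, Hausdorff, totally disconnected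
(profinite, Def 5.1 (i)) and a topological group; `Π_A` tempered (the discharged `hA`); and `{1} ⊆ Π_A` not open (so the
arithmetic side is not degenerate).  Companion of abc-iut-w6-d099's `capstoneDesignInputs_loopGraph_padicAffine`
(design column at the same datum). [cite: MochizukiSemiAnbd2006, Thm 5.4 (i) p.66] -/
theorem capstoneFrameInstances_loopGraph_padicAffine :
    Finite (IwahoriWitness.loopGraph p).graph.Vertex ∧ Finite (IwahoriWitness.loopGraph p).graph.Branch ∧
    Finite (IwahoriWitness.loopGraph p).graph.Edge ∧ Nonempty (IwahoriWitness.loopGraph p).graph.Edge ∧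
    CompactSpace (PadicAffine p) ∧ T2Space (PadicAffine p) ∧ TotallyDisconnectedSpace (PadicAffine p) ∧
    IsTopologicalGroup (PadicAffine p) ∧ IsTempered (PadicAffine p) ∧
    ¬ IsOpen ({1} : Set (PadicAffine p)) := by
  refine ⟨?_, ?_, ?_, ⟨⟨0⟩⟩, inferInstance, inferInstance, inferInstance, inferInstance, isTempered_padicAffine (p := p),
    not_isOpen_singleton_one_padicAffine p⟩
  · exact (show Finite PUnit.{1} from inferInstance)
  · exact (show Finite (ULift.{0} (Fin 1 × Bool)) from inferInstance)
  · exact (show Finite (ULift.{0} (Fin 1)) from inferInstance)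

/-- **The frame AND the design column together at one datum** (`𝒢₁`, `Π_A := Aff(ℤ_p)`, canonical chart, trivial outer
action): abc-iut-w6-d099's design-input certificate conjoined with the frame certificate above — the capstone's
binder frame + design inputs minus `hest` are jointly satisfiable at a profinite non-discrete `Π_A` (and `hest` fails
there, loc. cit.). [cite: MochizukiSemiAnbd2006, Thm 5.4 (i) p.66] -/
theorem capstoneFrameAndDesignInputs_loopGraph_padicAffine :
    (Finite (IwahoriWitness.loopGraph p).graph.Edge ∧ CompactSpace (PadicAffine p) ∧
      TotallyDisconnectedSpace (PadicAffine p) ∧ IsTempered (PadicAffine p)) ∧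
    (let c := (IwahoriWitness.loopGraph p).temperedPiChart (IwahoriWitness.loopGraph_prop36Hypotheses p)
    (IwahoriWitness.loopGraph p).Thm37Hypotheses ∧ (IwahoriWitness.loopGraph p).graph.IsGraph ∧
    Finite (IwahoriWitness.loopGraph p).graph.Vertex ∧ Finite (IwahoriWitness.loopGraph p).graph.Branch ∧
    Nonempty (IwahoriWitness.loopGraph p).graph.Edge ∧
    (∀ (a : PadicAffine p) (v : (IwahoriWitness.loopGraph p).graph.Vertex) (H : Subgroup c.G),
      H ∈ verticialSubgroups c v →
        ∃ φ : contMulAut c.G, TopOut.mk c.G φ = (1 : PadicAffine p →* TopOut c.G) a ∧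
          H.map (φ : MulAut c.G).toMonoidHom ∈
            verticialSubgroups c (((1 : PadicAffine p →* Aut (IwahoriWitness.loopGraph p).graph) a).hom.vertexMap v)) ∧
    (∀ (a : PadicAffine p) (e : (IwahoriWitness.loopGraph p).graph.Edge) (K : Subgroup c.G), K ∈ edgeLikeSubgroups c e →
      ∃ φ : contMulAut c.G, TopOut.mk c.G φ = (1 : PadicAffine p →* TopOut c.G) a ∧
        K.map (φ : MulAut c.G).toMonoidHom ∈
          edgeLikeSubgroups c (((1 : PadicAffine p →* Aut (IwahoriWitness.loopGraph p).graph) a).hom.edgeMap e)) ∧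
    (∃ U : Subgroup (PadicAffine p), IsOpen (U : Set (PadicAffine p)) ∧ ∀ a ∈ U,
      (∀ v, ((1 : PadicAffine p →* Aut (IwahoriWitness.loopGraph p).graph) a).hom.vertexMap v = v) ∧
      (∀ e, ((1 : PadicAffine p →* Aut (IwahoriWitness.loopGraph p).graph) a).hom.edgeMap e = e) ∧
        ∀ b, ((1 : PadicAffine p →* Aut (IwahoriWitness.loopGraph p).graph) a).hom.branchMap b = b) ∧
    NoBranchSwitching (IwahoriWitness.loopGraph p).graph.edgeOf
      (fun (a : PadicAffine p) (b : (IwahoriWitness.loopGraph p).graph.Branch) =>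
        ((1 : PadicAffine p →* Aut (IwahoriWitness.loopGraph p).graph) a).hom.branchMap b) ∧
    ¬ IsArithAmple (outerSemidirectProductSnd (1 : PadicAffine p →* TopOut c.G))
        (⊥ : Subgroup (outerSemidirectProduct (1 : PadicAffine p →* TopOut c.G))) ∧
    Nonempty (ChartRepresentatives c) ∧
    (∀ [TopologicalSpace (outerSemidirectProduct (1 : PadicAffine p →* TopOut c.G))]
      (R : ChartRepresentatives c),
      ¬ IsTotallyArithEstranged
          (decompositionDataOfChart R (toOuterSemidirectProduct (1 : PadicAffine p →* TopOut c.G)))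
          (outerSemidirectProductSnd (1 : PadicAffine p →* TopOut c.G)))) :=
  ⟨⟨(capstoneFrameInstances_loopGraph_padicAffine p).2.2.1, inferInstance, inferInstance, isTempered_padicAffine (p := p)⟩,
    capstoneDesignInputs_loopGraph_padicAffine p⟩

end ProfiniteSemiGraph

end Literature.AnabelianGeometry.SemiGraphs

end
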